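import Summits.ResolutionOfSingularities.ResolutionOfSingularities.Theorems.EquisingularLiftEquisingularLiftNatTowerRuledDefs
import Summits.ResolutionOfSingularities.ResolutionOfSingularities.Theorems.EquisingularLiftEquisingularLiftNatTowerPtRamInvTwo
import HarnessLib

/-!
# [OURS · L1 W4.5(b) · EL♮(3)] Rung TOWER₂ at `Ruled := DirLift.Ruled`: the point-step transport `DirLift.ruled_of_step_away` (res-L1-w45b-stub-4's /
# res-D-pv-029's stand-in `hRuled` DISCHARGED) and the (pt-ram) clause of the driver STAND-IN-FREE:
# `DirLift.towerPtRam₂_inv₂ : TowerPtRam₂ F₉ F₁₀ υ' (Tower.Inv₂ … (DirLift.Ruled O k θ P q Y) F₉ Z₉ hZ₉ F₁₀ υ')`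

Crux chain w45b (cell `res-hironaka`, slot W4.5(b)), working crux **EL♮** = stmt-ResolutionOfSingularities-20038, child **EL♮(3)** =
stmt-ResolutionOfSingularities-20148, route EquisingularLift, line `sections`; registered stub `stub_elnat_coneTowerPointResolution` @ `ReachTower₂`
(CHILD v19 4b326de54e94ad4b), driver `hsub_reachTower₂_of_invariant` (res-D-pv-029 p559837) at `INV₁ := Tower.Inv₂ … Ruled` (…NatTowerInvDefs v2
p556392). Written by res-L1-w45b-stub-2 g7 after RULED-DEFS (…NatTowerRuledDefs, res-L1-w45b-plan-1 NAMING 2026-08-27T19:11:35Z, item (ii)).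
HONEST FRAMING: OURS; NOT a statement of any manuscript; AI-written, weaker than expert review. No `sorry`; standard axioms; DEF-FREE.
`--supports stmt-ResolutionOfSingularities-20148 --as helper`.

WHAT.
* `DirLift.ruled_of_step_away` — res-L1-w45b-stub-4's ruled-datum transport hypothesis `hRuled` of `Tower.inv₂_pointCentre_transport/_forget`
  (…NatTowerInvTwoPointCentre p560059-era) / `Tower.towerPtRam₂_inv₂` (…NatTowerPtRamInvTwo p560137) / res-D-pv-029's `Tower.towerPtReg₂_inv₂`,
  VERBATIM in shape, PROVED for `Ruled := DirLift.Ruled O k θ P q Y`: a step `τ₀ : X₀'' ⟶ X₀` with model-square compatibility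
  `j₀' ≫ τ₀ = υ₀ ≫ j₀` and an isomorphism `V(𝓔₀·𝒪_{X₀''}) ≅ V(𝓔₀)` over `τ₀` transports the datum to `𝓔₀·𝒪_{X₀''}` at the new stage, for the
  transported surface `closure υ₀⁻¹(E₀ ∖ {y₀})` — one application of `DirLift.ruled_comp` (the hypotheses «model square» and «`y₀ ∉ E₀`» of the
  stand-in are not needed by the transport and are kept only to match its shape).
* `DirLift.towerPtRam₂_inv₂` — stub-4's `Tower.towerPtRam₂_inv₂` with `Ruled := DirLift.Ruled …` and `hRuled := DirLift.ruled_of_step_away …`: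
  **the (pt-ram) hypothesis of the driver with NO stand-in.**

References (index only): res-L1-w45b-stub-4 `towerPtRam_brick` p550227 · p552505 · p555772 · p558073 · p560137; res-D-pv-029 …NatTowerInvDefs,
…NatTowerDriverTwo p559837; res-L1-w45b-lead-2 …NatTowerReachTwoDefs p556233.
-/

set_option linter.dupNamespace false -- mandated namespace `Summit.<Summit>.<Problem>` of this single-conjunct summit
set_option linter.overlappingInstances false -- the binders carry `[IsDomain O] [IsDiscreteValuationRing O]`

noncomputable section

open CategoryTheory CategoryTheory.Limits AlgebraicGeometry TopologicalSpace Topology IsLocalRing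
open Literature.AlgebraicGeometry.Resolution
open AlgebraicGeometry.Scheme.IdealSheafData
open Summit.ResolutionOfSingularities.ResolutionOfSingularities.Theses.EquisingularLift.Split

namespace Summit.ResolutionOfSingularities.ResolutionOfSingularities.Cruxes.EquisingularLiftNat.Sections

/-- **The point-step transport of `DirLift.Ruled`** = res-L1-w45b-stub-4's / res-D-pv-029's stand-in `hRuled` («ruled_of_step_away»), verbatim
in shape, for `Ruled := DirLift.Ruled O k θ P q Y`. The model square of the new stage and `y₀ ∉ E₀` are part of the stand-in's shape but not
used: the transport is `DirLift.ruled_comp` along `τ₀` with the given isomorphism over `τ₀`. [OURS · pure logic over …NatTowerRuledDefs] -/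
theorem DirLift.ruled_of_step_away (O : Type) [CommRing O] (k : Type) [Field k] (θ : O →+* k)
    (P : Scheme.{0}) (q : P ⟶ Spec (.of O)) (Y : Set P)
    (F₉ : Scheme.{0}) (Z₉ : Set F₉) (hZ₉ : IsClosed Z₉) (F₁₀ : Scheme.{0}) (υ' : F₁₀ ⟶ F₉) :
    ∀ (G₀ G₀' : Scheme.{0}) (γ₀ : G₀ ⟶ F₁₀) (E₀ : Set G₀) (X₀ X₀'' : Scheme.{0}) (σ₀ : X₀ ⟶ P) (j₀ : G₀ ⟶ X₀)
        (j₀' : G₀' ⟶ X₀'') (t₀' : G₀' ⟶ Spec (.of k)) (𝓔₀ : X₀.IdealSheafData) (τ₀ : X₀'' ⟶ X₀) (υ₀ : G₀' ⟶ G₀) (y₀ : G₀),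
      j₀' ≫ τ₀ = υ₀ ≫ j₀ → IsPullback j₀' t₀' ((τ₀ ≫ σ₀) ≫ q) (Spec.map (CommRingCat.ofHom θ)) → y₀ ∉ E₀ →
      (∃ e : (𝓔₀.comap τ₀).subscheme ≅ 𝓔₀.subscheme, e.hom ≫ 𝓔₀.subschemeι = (𝓔₀.comap τ₀).subschemeι ≫ τ₀) →
      DirLift.Ruled O k θ P q Y F₉ Z₉ hZ₉ F₁₀ υ' G₀ γ₀ E₀ X₀ σ₀ j₀ 𝓔₀ →
      DirLift.Ruled O k θ P q Y F₉ Z₉ hZ₉ F₁₀ υ' G₀' (υ₀ ≫ γ₀) (closure (υ₀ ⁻¹' (E₀ \ {y₀}))) X₀'' (τ₀ ≫ σ₀) j₀' (𝓔₀.comap τ₀) := by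
  intro G₀ G₀' γ₀ E₀ X₀ X₀'' σ₀ j₀ j₀' t₀' 𝓔₀ τ₀ υ₀ y₀ hcomm _ _ he h
  obtain ⟨e, he⟩ := he
  exact DirLift.ruled_comp h τ₀ υ₀ j₀' hcomm (𝓔₀.comap τ₀) e he _

/-- **The (pt-ram) clause of the TOWER₂ driver at `INV₁ := Tower.Inv₂ … (DirLift.Ruled …)`, STAND-IN-FREE**: res-L1-w45b-stub-4's
`Tower.towerPtRam₂_inv₂` (…NatTowerPtRamInvTwo) with its ruled-datum transport hypothesis discharged by `DirLift.ruled_of_step_away`.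
[OURS · L1 W4.5b] toward `stub_elnat_coneTowerPointResolution` (stmt-ResolutionOfSingularities-20148 / -20038); NOT a statement of the manuscript. -/
theorem DirLift.towerPtRam₂_inv₂ (O : Type) [CommRing O] [IsDomain O] [IsDiscreteValuationRing O] [IsAdicComplete (maximalIdeal O) O]
    [IsAlgClosed (ResidueField O)] (k : Type) [Field k] (θ : O →+* k) (hθ : Function.Surjective θ)
    (P : Scheme.{0}) (q : P ⟶ Spec (.of O)) (Y : Set P) (hYsp : Y ⊆ q ⁻¹' {closedPoint O}) (hYirr : IsIrreducible Y)
    (hYcl : IsClosed Y) [IsProper q] [IsIntegral P] (hPnoeth : IsLocallyNoetherian P) (hPreg : Scheme.IsRegular P)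
    [SmoothOfRelativeDimension 3 q]
    (Ch : ∀ X' : Scheme.{0}, (X' ⟶ P) → Set X' → Prop)
    (hChain : ∀ (X' : Scheme.{0}) (σ : X' ⟶ P) (S : Set X'), Ch X' σ S → Chain P Y X' σ S)
    (hStep : ∀ (X' X'' : Scheme.{0}) (σ' : X' ⟶ P) (S' : Set X') (C : X'.IdealSheafData) (τ : X'' ⟶ X'),
      Ch X' σ' S' → IsBlowup τ C → Scheme.IsRegular C.subscheme → Flat (C.subschemeι ≫ σ' ≫ q) →
      σ' '' (C.support : Set X') ⊆ {x : P | ¬ IsGenericPoint x Y} →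
      (C.support : Set X') ∩ (σ' ≫ q) ⁻¹' {closedPoint O} ⊆ S' →
      Ch X'' (τ ≫ σ') (closure (τ ⁻¹' (S' \ (C.support : Set X')))))
    (F₉ : Scheme.{0}) (Z₉ : Set F₉) (hZ₉ : IsClosed Z₉) (F₁₀ : Scheme.{0}) (υ' : F₁₀ ⟶ F₉) :
    TowerPtRam₂ F₉ F₁₀ υ' (Tower.Inv₂ O k θ P q Y Ch (DirLift.Ruled O k θ P q Y) F₉ Z₉ hZ₉ F₁₀ υ') :=
  Tower.towerPtRam₂_inv₂ O k θ hθ P q Y hYsp hYirr hYcl hPnoeth hPreg Ch hChain hStep (DirLift.Ruled O k θ P q Y) F₉ Z₉ hZ₉ F₁₀ υ'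
    (DirLift.ruled_of_step_away O k θ P q Y F₉ Z₉ hZ₉ F₁₀ υ')

end Summit.ResolutionOfSingularities.ResolutionOfSingularities.Cruxes.EquisingularLiftNat.Sections

end
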